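/-
HONEST FRAMING: certified error envelopes and provably optimal rounding/accumulation schemes for
low-precision formats under stated cost models; every table by two implementations; no hardware
or vendor claims.
-/
import Summits.Ventures.CertifiedArithmetic.LowPrec.OptDemotionRoutingMono

/-!
# The demotion law (Theorem T8), part 8l: the routing value BY VALUE, and opt's two-tree inequality (TT)

Value-level packaging of parts 8h–8i for the un-carry descent (opt gen 13 R20): `bitsOf x` (the
binary expansion of a dyadic rational, by uniqueness `eq_of_val_eq`), `IsQFloat q x` (a positive
`q`-bit float with unbounded exponent: the value of a routable nonempty configuration),
`treeBRv q t x := BR_t(bitsOf x)`; the symmetry of the node (`treeBRw_node_comm`); monotonicity (M) and midpoint convexity (MC) restated by value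
(`treeBRv_mono`, `treeBRv_midconvex`); and the precise statement of opt's TWO-TREE INEQUALITY
`TT q` (gen13/README §4 (UC-II′) box, R20(a)), in the budget units of part 7 (`σ = 2^(q-1)`,
`u σ = ½`): for `β = 2^k` (`0 ≤ k ≤ q-2`), `o = σ - β + A + ½` (`A < β`), `e = β + B`
(`B < σ - β`, bit `k` of `B` clear):
`BR_a(o) + BR_b(e) ≤ max (BR_a(o+β-½) + BR_b(e-β+½)) (BR_a(o-β) + BR_b(e+β))`.
(TT) is OPEN (certified by opt on 15 063 208 exact instances, C33); part 8m derives `LRL q` from it.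
-/

namespace Summit.Ventures.CertifiedArithmetic.LowPrec.Opt

open Literature.ComputerArithmetic.JeannerodRump2018
open Literature.ComputerArithmetic.JeannerodRump2018.SumTree

/-! ## Binary expansions by value -/

open Classical in
/-- The binary expansion of `x` (the finite set of exponents with `Σ 2^e = x`), `∅` if none. -/
noncomputable def bitsOf (x : ℚ) : Finset ℤ :=
  if h : ∃ S : Finset ℤ, val S = x then h.choose else ∅

/-- `bitsOf` of a value with a binary expansion has that value. -/
theorem val_bitsOf {x : ℚ} (h : ∃ S : Finset ℤ, val S = x) : val (bitsOf x) = x := by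
  have : bitsOf x = h.choose := by unfold bitsOf; exact dif_pos h
  rw [this]; exact h.choose_spec

/-- `bitsOf (val S) = S` (uniqueness of binary expansions, part 8i′). -/
theorem bitsOf_val (S : Finset ℤ) : bitsOf (val S) = S :=
  eq_of_val_eq _ _ (val_bitsOf ⟨S, rfl⟩)

/-- A POSITIVE `q`-BIT FLOAT (unbounded exponent): the value of a routable nonempty configuration. -/
def IsQFloat (q : ℕ) (x : ℚ) : Prop := ∃ S : Finset ℤ, S.Nonempty ∧ Routable q S ∧ val S = x

/-- The expansion of a `q`-bit float is routable and nonempty. -/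
theorem IsQFloat.bitsOf {q : ℕ} {x : ℚ} (h : IsQFloat q x) :
    (bitsOf x).Nonempty ∧ Routable q (bitsOf x) ∧ val (bitsOf x) = x := by
  obtain ⟨S, hne, hS, rfl⟩ := h
  rw [bitsOf_val]; exact ⟨hne, hS, rfl⟩

/-- A `q`-bit float is positive. -/
theorem IsQFloat.pos {q : ℕ} {x : ℚ} (h : IsQFloat q x) : 0 < x := by
  obtain ⟨S, hne, -, rfl⟩ := h
  exact lt_of_lt_of_le (zpow_pos (by norm_num) _) (two_zpow_le_val hne)

/-- THE ROUTING VALUE BY VALUE: `BR_t(x) := BR_t(bitsOf x)` (`BR_t(0) = 0`). -/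
noncomputable def treeBRv (q : ℕ) (t : SumTree) (x : ℚ) : ℚ := treeBR q t (bitsOf x)

/-- `treeBRv q t (val S) = treeBR q t S`. -/
theorem treeBRv_val (q : ℕ) (t : SumTree) (S : Finset ℤ) : treeBRv q t (val S) = treeBR q t S := by
  rw [treeBRv, bitsOf_val]

/-- `BR ≥ 0` by value. -/
theorem treeBRv_nonneg (q : ℕ) (t : SumTree) (x : ℚ) : 0 ≤ treeBRv q t x := treeBR_nonneg q t _

/-- (M) BY VALUE: `x ≤ y` floats ⟹ `BR_t(x) ≤ BR_t(y)` (`q ≥ 1`). -/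
theorem treeBRv_mono {q : ℕ} (hq : 1 ≤ q) (t : SumTree) {x y : ℚ} (hx : IsQFloat q x)
    (hy : IsQFloat q y) (hxy : x ≤ y) : treeBRv q t x ≤ treeBRv q t y := by
  obtain ⟨hne, hS, hv⟩ := hx.bitsOf
  obtain ⟨hne', hS', hv'⟩ := hy.bitsOf
  exact treeBR_mono hq t hne hne' hS hS' (by rw [hv, hv']; exact hxy)

/-- `BR_t(0) ≤ BR_t(y)` for a float `y` (the empty configuration scores `0`). -/
theorem treeBRv_zero_le {q : ℕ} (t : SumTree) (y : ℚ) : treeBRv q t 0 ≤ treeBRv q t y := by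
  have : bitsOf 0 = ∅ := by rw [← val_empty, bitsOf_val]
  rw [treeBRv, this, treeBR, treeBRw_empty]
  exact treeBRv_nonneg q t y

/-- (MC) BY VALUE: `x` a float with bit `2^k`, `x + 2^k` a float ⟹
`2 BR_t(x) ≤ BR_t(x + 2^k) + BR_t(x - 2^k)`. -/
theorem treeBRv_midconvex {q : ℕ} (t : SumTree) {x : ℚ} (hx : IsQFloat q x) {k : ℤ}
    (hk : k ∈ bitsOf x) (hx' : IsQFloat q (x + (2 : ℚ) ^ k)) :
    2 * treeBRv q t x ≤ treeBRv q t (x + (2 : ℚ) ^ k) + treeBRv q t (x - (2 : ℚ) ^ k) := by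
  classical
  obtain ⟨hne, hS, hv⟩ := hx.bitsOf
  set S := bitsOf x with hSdef
  -- the maximal run of set bits from k
  have hex : ∃ j : ℕ, k + ((j : ℤ) + 1) ∉ S := by
    refine ⟨(S.max' hne - k).toNat, fun h => ?_⟩
    have h1 := Finset.le_max' S _ h
    have h2 : k ≤ S.max' hne := Finset.le_max' S k hk
    have h3 : (((S.max' hne - k).toNat : ℕ) : ℤ) = S.max' hne - k := Int.toNat_of_nonneg (by linarith)
    linarith
  let j := Nat.find hex
  have hj : k + ((j : ℤ) + 1) ∉ S := Nat.find_spec hex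
  have hrun : ∀ i : ℕ, i ≤ j → k + (i : ℤ) ∈ S := by
    intro i hi
    rcases Nat.eq_zero_or_pos i with rfl | hpos
    · simpa using hk
    · have := Nat.find_min hex (show i - 1 < j by omega)
      rw [not_not] at this
      have e1 : (((i - 1 : ℕ) : ℤ) + 1) = (i : ℤ) := by rw [Nat.cast_sub (by omega)]; push_cast; ring
      rwa [e1] at this
  set run : Finset ℤ := (Finset.range (j + 1)).image fun i : ℕ => k + (i : ℤ) with hrundef
  have hrunS : run ⊆ S := by
    intro r hr
    obtain ⟨i, hi, rfl⟩ := Finset.mem_image.1 hr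
    exact hrun i (by rw [Finset.mem_range] at hi; omega)
  set Splus := insert (k + ((j : ℤ) + 1)) (S \ run) with hSplus
  -- its value is x + 2^k, so it is the expansion of x + 2^k
  have hval : val Splus = x + (2 : ℚ) ^ k := by
    have hβ'S : k + ((j : ℤ) + 1) ∉ S \ run := fun h => hj (Finset.mem_sdiff.1 h).1
    have e1 : val Splus = (2 : ℚ) ^ (k + ((j : ℤ) + 1)) + val (S \ run) := by rw [hSplus, val_insert hβ'S]
    have e2 : val S = val (S \ run) + val run := val_eq_sdiff_add hrunS
    have e3 : val run = (2 : ℚ) ^ (k + ((j : ℤ) + 1)) - (2 : ℚ) ^ k := by rw [hrundef]; exact val_run k j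
    linarith
  have hplus : bitsOf (x + (2 : ℚ) ^ k) = Splus := by rw [← hval, bitsOf_val]
  obtain ⟨-, hS', -⟩ := hx'.bitsOf
  rw [hplus] at hS'
  have hminus : bitsOf (x - (2 : ℚ) ^ k) = S.erase k := by
    have : val (S.erase k) = x - (2 : ℚ) ^ k := by
      have := val_eq_add_erase hk; rw [hv] at this; linarith
    rw [← this, bitsOf_val]
  rw [treeBRv, treeBRv, treeBRv, hplus, hminus, ← hSdef, hSplus]
  exact treeBR_midconvex t hS hrun hj hS'

/-! ## Symmetry of the node -/

/-- Swapping the parts of a valid split. -/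
theorem swap_mem_splits {q : ℕ} {S : Finset ℤ} {e₀ : ℤ} {A B : Finset ℤ} (h : (A, B) ∈ splits q S e₀) :
    (B, A) ∈ splits q S e₀ := by
  obtain ⟨h1, hA, hB⟩ := mem_splits.1 h
  refine mem_splits.2 ⟨?_, hB, hA⟩
  rcases h1 with ⟨hs, hB'⟩ | ⟨hs, hB'⟩ <;> simp only at hs hB' ⊢
  · left; rw [hB']
    exact ⟨Finset.sdiff_subset, (Finset.sdiff_sdiff_eq_self hs).symm⟩
  · right; rw [hB']
    exact ⟨Finset.sdiff_subset, (Finset.sdiff_sdiff_eq_self hs).symm⟩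

/-- The node is symmetric in its children. -/
theorem treeBRw_node_comm (q : ℕ) (W : ℤ → ℚ) (a b : SumTree) (S : Finset ℤ) :
    treeBRw q W (.node a b) S = treeBRw q W (.node b a) S := by
  suffices h : ∀ a b : SumTree, treeBRw q W (.node a b) S ≤ treeBRw q W (.node b a) S from
    le_antisymm (h a b) (h b a)
  intro a b
  by_cases hne : S.Nonempty
  · rcases treeBRw_node_eq (q := q) (W := W) (a := a) (b := b) hne with h0 | ⟨AB, hAB, hval⟩
    · rw [h0, treeBRw_node q W b a hne]
      linarith [fold_max_nonneg (splits q S (S.max' hne)) (fun AB => treeBRw q W b AB.1 + treeBRw q W a AB.2)]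
    · rw [hval]
      have := split_le_treeBRw_node (q := q) (W := W) (a := b) (b := a) hne (swap_mem_splits hAB)
      linarith
  · rw [Finset.not_nonempty_iff_eq_empty.1 hne, treeBRw_empty, treeBRw_empty]

/-! ## opt's two-tree inequality (TT) -/

/-- **opt's TWO-TREE INEQUALITY (TT)** (gen13/README §4 box, R20(a); OPEN; certified C33 on
15 063 208 exact instances incl. subtrees of 25 267 leaves) in budget units (`σ = 2^(q-1)`, half ulp
`½`): for all subtrees `a, b`, every level `β = 2^k` (`0 ≤ k ≤ q - 2`), every `A < β` and every
`B < σ - β` with bit `k` clear (naturals), with `o = σ - β + A + ½` (the child holding the half ulp,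
all ones from `σ/2` down to `β`) and `e = β + B`:
`BR_a(o) + BR_b(e) ≤ max (BR_a(o + β - ½) + BR_b(e - β + ½)) (BR_a(o - β) + BR_b(e + β))` —
re-assembling the parent's leading bit `σ` (split as `o + e ∋ σ/2 + … + β` twice) never loses. -/
def TT (q : ℕ) : Prop :=
  ∀ (a b : SumTree) (k A B : ℕ), k + 2 ≤ q → A < 2 ^ k → B + 2 ^ k < 2 ^ (q - 1) →
    B.testBit k = false →
    let β : ℚ := (2 : ℚ) ^ k
    let o : ℚ := (2 : ℚ) ^ (q - 1) - β + A + 1 / 2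
    let e : ℚ := β + B
    treeBRv q a o + treeBRv q b e ≤
      max (treeBRv q a (o + β - 1 / 2) + treeBRv q b (e - β + 1 / 2))
        (treeBRv q a (o - β) + treeBRv q b (e + β))

end Summit.Ventures.CertifiedArithmetic.LowPrec.Opt
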